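import Summits.AtomisticToContinuum.BoseEinsteinCondensation.Theorems.BECRichardsonGaudinBeliaevDeformationBoundCompleteCondensation
import Summits.AtomisticToContinuum.BoseEinsteinCondensation.Theorems.BECProbeMassFlowRecoilTransferCompleteCondensation

/-!
# Calibration of the crux `BeliaevDeformationBound` against the canonical periodic
# complete-condensation statement, the sibling route `BECProbeMassFlow`, and the
# Strong-Hypothesis Library (D-0034)

Route `BECRichardsonGaudin`, crux `BeliaevDeformationBound` (item `stmt-AtomisticToContinuum-14804`), line
`registered`, lead c3. Pure logic on LANDED theorems; no definition, no analysis.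

What is already in the tree: `beliaevDeformationBound_iff_completeCondensation` (this crux `↔` complete
condensation of the SOFT periodic dilute gas: every `ε > 0`, small `ρ`, eventually in `N`, the
`δ`-near-minimisers of `periodicEnergy v` on the torus of side `sideLength ρ N` have `n₀ ≥ (1 − ε)N`), and, in
the sibling route `BECProbeMassFlow`, `completeCondensation_of_cloudMomentumAtom` /
`recoilTransfer_iff_completeCondensation_of_cloudMomentumAtom` (its two cruxes `↔` the SAME statement for
ALL repulsive finite-range `v`, written inline in one canonical shape).

What this file adds (so that the kernel tribunal `t1a`/`t1c` scans and the item connectome see it):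

* `completeCondensationPeriodic_of_guarded` — the `ε < 1`-guarded form of periodic complete condensation
  (the shape of the registered Dirichlet hypothesis
  `Literature.StrongHypotheses.AtomisticToContinuum.CompleteCondensationDilute`, B1 of the D-0034 census)
  already gives the unguarded canonical form (for `ε ≥ 1` the bound `ofReal ((1 − ε)N) = 0` is empty).
* `beliaevDeformationBound_of_completeCondensationPeriodic` — canonical periodic complete condensation for
  all repulsive finite-range `v` (verbatim the hypothesis of `periodicBEC_of_completeCondensation` and the
  conclusion of `completeCondensation_of_cloudMomentumAtom`) implies this crux (restrict to soft `v`);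
  `beliaevDeformationBound_of_completeCondensationPeriodic_guarded` — the same from the guarded form.
* `beliaevDeformationBound_of_cloudMomentumAtom_of_recoilTransfer` — hence the two cruxes of route
  `BECProbeMassFlow` (`CloudMomentumAtom`, stmt-…-12310-class; `RecoilTransfer`, stmt-AtomisticToContinuum-12311)
  imply this crux: an explicit cross-route edge of the sub-problem's item graph.

Relation to the Strong-Hypothesis Library (recorded, NOT provable here): B1 `CompleteCondensationDilute` is the
DIRICHLET twin (`condensateNumber` = `λ_max(γ)` of the Dirichlet ground state, all `v`, `ε < 1`) of the periodic
statement this crux is equivalent to (zero-mode occupation `condensateOccupation` of periodic near-minimisers,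
soft `v`). Neither implication between the twins is in the tree or in print: transferring a condensate
FRACTION between boundary conditions needs control of the state, not of the energy (the energy analogue is the
discharged `LSSY2005_e0_periodic_eq_dirichlet_offCritical_holds`; the `∃ c` periodic → Dirichlet transfer is the
open shared crux `BoundaryTransferWeak`, stmt-AtomisticToContinuum-0827). So the kernel cannot place this crux
against B1; a judge places it by `beliaevDeformationBound_iff_completeCondensation` + LSSY2005 Ch. 5.

References: LSSY2005 = Lieb–Seiringer–Solovej–Yngvason (2005) §1.2 (1.17)–(1.19), Ch. 5; D-0034 census
`Literature/StrongHypotheses/AtomisticToContinuum.lean` rows B1–B4.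
-/

namespace Summit.AtomisticToContinuum.BoseEinsteinCondensation.Theorems.BeliaevDeformationBound

open scoped ENNReal
open MeasureTheory Filter
open Literature.MathematicalPhysics.QuantumManyBody.BoseGas
open Summit.AtomisticToContinuum.BoseEinsteinCondensation.Theses.BECRichardsonGaudin (BeliaevDeformationBound)
open Summit.AtomisticToContinuum.BoseEinsteinCondensation.Theses.BECProbeMassFlow (CloudMomentumAtom RecoilTransfer)

noncomputable section

/-- **The `ε < 1` guard is immaterial.** If complete condensation of the periodic dilute gas holds for every
`ε ∈ (0, 1)` (the shape of the registered Dirichlet hypothesis `CompleteCondensationDilute`), it holds for every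
`ε > 0`: for `ε ≥ 1` the required bound `ofReal ((1 − ε)N) ≤ n₀` has left side `0`, and the slack `δ := 1`
serves. [folklore] -/
theorem completeCondensationPeriodic_of_guarded
    (h : ∀ v : ℝ → ℝ≥0∞, IsRepulsiveFiniteRange v → ∀ ε : ℝ, 0 < ε → ε < 1 →
      ∃ ρ₀ : ℝ, 0 < ρ₀ ∧ ∀ ρ : ℝ, 0 < ρ → ρ < ρ₀ →
        ∀ᶠ N : ℕ in Filter.atTop, ∃ δ : ℝ≥0∞, 0 < δ ∧ ∀ Ψ : PeriodicTrialState N (sideLength ρ N),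
          periodicEnergy v Ψ ≤ periodicGroundStateEnergy v N (sideLength ρ N) + δ →
            ENNReal.ofReal ((1 - ε) * N) ≤ condensateOccupation N (sideLength ρ N) Ψ.ψ) :
    ∀ v : ℝ → ℝ≥0∞, IsRepulsiveFiniteRange v → ∀ ε : ℝ, 0 < ε →
      ∃ ρ₀ : ℝ, 0 < ρ₀ ∧ ∀ ρ : ℝ, 0 < ρ → ρ < ρ₀ →
        ∀ᶠ N : ℕ in Filter.atTop, ∃ δ : ℝ≥0∞, 0 < δ ∧ ∀ Ψ : PeriodicTrialState N (sideLength ρ N),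
          periodicEnergy v Ψ ≤ periodicGroundStateEnergy v N (sideLength ρ N) + δ →
            ENNReal.ofReal ((1 - ε) * N) ≤ condensateOccupation N (sideLength ρ N) Ψ.ψ := by
  intro v hv ε hε
  by_cases hε1 : ε < 1
  · exact h v hv ε hε hε1
  · refine ⟨1, one_pos, fun ρ _ _ => Filter.Eventually.of_forall fun N => ⟨1, one_pos, fun Ψ _ => ?_⟩⟩
    have h0 : (1 - ε) * (N : ℝ) ≤ 0 :=
      mul_nonpos_of_nonpos_of_nonneg (by linarith [not_lt.mp hε1]) N.cast_nonneg
    rw [ENNReal.ofReal_of_nonpos h0]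
    exact bot_le

/-- **Canonical periodic complete condensation (all repulsive finite-range `v`) implies the crux.** The
hypothesis is verbatim the canonical inline statement of the sub-problem (hypothesis of
`periodicBEC_of_completeCondensation`, conclusion of `completeCondensation_of_cloudMomentumAtom`); restrict it
to soft `v` (`∫ v(|x|) dx < ∞`) and apply the landed sandwich `beliaevDeformationBound_of_completeCondensation`
(p147698). This is the `H → C` edge the D-0034 kernel looks for, for the PERIODIC twin of the registered
hypothesis `CompleteCondensationDilute`. [folklore] -/
theorem beliaevDeformationBound_of_completeCondensationPeriodic
    (h : ∀ v : ℝ → ℝ≥0∞, IsRepulsiveFiniteRange v → ∀ ε : ℝ, 0 < ε →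
      ∃ ρ₀ : ℝ, 0 < ρ₀ ∧ ∀ ρ : ℝ, 0 < ρ → ρ < ρ₀ →
        ∀ᶠ N : ℕ in Filter.atTop, ∃ δ : ℝ≥0∞, 0 < δ ∧ ∀ Ψ : PeriodicTrialState N (sideLength ρ N),
          periodicEnergy v Ψ ≤ periodicGroundStateEnergy v N (sideLength ρ N) + δ →
            ENNReal.ofReal ((1 - ε) * N) ≤ condensateOccupation N (sideLength ρ N) Ψ.ψ) :
    BeliaevDeformationBound :=
  beliaevDeformationBound_of_completeCondensation fun v hv _ ε hε => h v hv ε hε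

/-- **The same from the `ε < 1`-guarded form** (the exact quantifier shape of B1
`CompleteCondensationDilute`, transposed to the torus): compose `completeCondensationPeriodic_of_guarded`
with `beliaevDeformationBound_of_completeCondensationPeriodic`. [folklore] -/
theorem beliaevDeformationBound_of_completeCondensationPeriodic_guarded
    (h : ∀ v : ℝ → ℝ≥0∞, IsRepulsiveFiniteRange v → ∀ ε : ℝ, 0 < ε → ε < 1 →
      ∃ ρ₀ : ℝ, 0 < ρ₀ ∧ ∀ ρ : ℝ, 0 < ρ → ρ < ρ₀ →
        ∀ᶠ N : ℕ in Filter.atTop, ∃ δ : ℝ≥0∞, 0 < δ ∧ ∀ Ψ : PeriodicTrialState N (sideLength ρ N),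
          periodicEnergy v Ψ ≤ periodicGroundStateEnergy v N (sideLength ρ N) + δ →
            ENNReal.ofReal ((1 - ε) * N) ≤ condensateOccupation N (sideLength ρ N) Ψ.ψ) :
    BeliaevDeformationBound :=
  beliaevDeformationBound_of_completeCondensationPeriodic (completeCondensationPeriodic_of_guarded h)

/-- **Cross-route edge: the two cruxes of route `BECProbeMassFlow` imply this crux.** `CloudMomentumAtom`
and `RecoilTransfer` give canonical periodic complete condensation for all repulsive finite-range `v`
(`completeCondensation_of_cloudMomentumAtom`, landed in
`Theorems/BECProbeMassFlowRecoilTransferCompleteCondensation.lean`), hence `BeliaevDeformationBound` by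
`beliaevDeformationBound_of_completeCondensationPeriodic`. Both routes therefore meet at the same open
statement (complete BEC of the dilute periodic gas in the thermodynamic limit, LSSY2005 Ch. 5): this crux is its
soft-potential slice, route `BECProbeMassFlow`'s pair of cruxes is (given `CloudMomentumAtom`) the full
statement. [folklore] -/
theorem beliaevDeformationBound_of_cloudMomentumAtom_of_recoilTransfer
    (h1 : CloudMomentumAtom) (h2 : RecoilTransfer) : BeliaevDeformationBound :=
  beliaevDeformationBound_of_completeCondensationPeriodic (completeCondensation_of_cloudMomentumAtom h1 h2)

end

end Summit.AtomisticToContinuum.BoseEinsteinCondensation.Theorems.BeliaevDeformationBound
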